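import Literature.AnabelianGeometry.EtaleTheta.ArithThetaTowerCarrier
import Mathlib.Algebra.Divisibility.Prod
import HarnessLib

/-!
# [EtTh] Prop. 1.4 (i) / Def. 4.1 (i) shape AT THE CARRIER (GAP A, item GA-02 add-on): the zero and polar divisors of the theta section of
# `ArithThetaTower.divisorMonoids d T` as elements of `Φ₀(Ÿ_T)`, RELATIVELY PRIME, with `div₀ θ · [poles] = [zeros]`

S. Mochizuki, *The étale theta function …*, Publ. RIMS **45** (2009) [MochizukiEtTh2009], Prop. 1.4 (i) PDF p.21 («the zeroes of `Θ̈` … are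
precisely the cusps …; the divisor of poles … is precisely the divisor `D_1`»), Def. 3.3 (iii) p.73, Def. 4.1 (i) p.86 («a *fraction-pair* … such
that … `Div(s′)`, `Div(s″)` have disjoint supports») [cite: MochizukiEtTh2009, Def 4.1 (i) p.86]; [IUTchI] Ex. 3.2 (ii) p.70 («`Θ̲_v ∈
𝒪^×(T^÷_{Ÿ_v})`») [claim: Mochizuki2012, status: disputed — nothing of the series is asserted].

abc-iut cell, GAP A = G-L5-EX32I-1, item **GA-02** (seat abc-iut-gapA-02-divisorMonoids): PROOF-ONLY add-on to ★ p671144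
`ArithThetaTowerCarrier.lean` (landed files are append-only, so the add-on is a new file), serving GA-12's discharge of S0's
`CarrierSpec.theta` field (`∃ θ Z Pl, Z ∈ csp₀ ∧ Pl ∈ ncsp₀ ∧ Z ≠ 1 ∧ Pl ≠ 1 ∧ IsRelPrime Z Pl ∧ divΛ θ · of (toR Pl) = of (toR Z)`, GA-04 ★ p667989)
and GA-06's `Θ̲` at the term, BY NAME:
* `thetaZerosCarrier d T := (1, thetaZerosGeom' d T)` and `thetaPolesCarrier d T := (1, thetaPolesGeom' d T)` — the zero / polar divisors of the
  theta section `thetaB₀ d T` as elements of `Φ₀(Ÿ_T) = ord(𝒪^▷_{K_v̲}) × Φ₀^geom(Ÿ_T)` (trivial constants' coordinate);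
* memberships `thetaZerosCarrier_mem_csp₀` (CUSPIDAL), `thetaPolesCarrier_mem_ncsp₀` (NON-CUSPIDAL), `… _ne_one`;
* **`isRelPrime_thetaZerosCarrier_thetaPolesCarrier`** — the two are RELATIVELY PRIME in the monoid `Φ₀(Ÿ_T)` (every common divisor is a unit):
  a common divisor's geometric values are effective log-divisors bounded by `[cusps]` (no component) and by `[F_x]` (no cusp), hence trivial;
  its constants' coordinate divides `1`;
* **`div₀_thetaB₀_mul : div₀ θ · ι₂(of [poles]) = ι₂(of [zeros])`** in `Φ₀(Ÿ_T)^gp` (+ `gpMap_inr_of_thetaPolesGeom'`/`_thetaZerosGeom'`: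
  `ι₂(of ·) = of thetaPolesCarrier / of thetaZerosCarrier`) — the Def. 4.1 (i) relation `s′·(s″)⁻¹ = θ` read on divisors.

No definition of mathematical content beyond the two named elements (abbreviation-style `def`s), no instance, no notation, no sorry.  HONEST
FRAMING: laws over typed interfaces at a DECREED finite avatar (labels of ★ p671144 apply: ⊕-DECOUPLED; (c3′)/GUARD; only Prop 1.4 (i)'s cusp half
transported, the pole `D_1 := [F_{1·Π_Ÿ}]` decreed); no side on [IUTchIII] Cor. 3.12; typed ≠ inhabited ≠ proved-in-print; count-neutral; NO abc claim.
-/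

noncomputable section

namespace Literature.AnabelianGeometry.EtaleTheta

open CategoryTheory Opposite Function Literature.AlgebraicGeometry.Frobenioids
  Literature.AlgebraicGeometry.Frobenioids.PadicFrd Literature.AnabelianGeometry.SemiGraphs Literature.IUT.HodgeTheaters
  LogDivisorModel LogDivisorModel.GaloisAction

namespace ArithThetaTower

variable {p : ℕ} [Fact p.Prime] (d : GaloisValDatum.{0} p) {P : Type} [Group P] [TopologicalSpace P]
  (T : BadLocalGroupDatum d.Gal P)

/-- **The zero divisor `[cusps]` of the theta section as an element of `Φ₀(Ÿ_T)`** (constants' coordinate trivial).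
[cite: MochizukiEtTh2009, Prop 1.4 p.21] -/
def thetaZerosCarrier : OrdInt (constFld d T T.ydd).K × (deckAction d T).phiZero (cptGSet d T) := (1, thetaZerosGeom' d T)

/-- **The polar divisor `[D_1]` (and its translates) of the theta section as an element of `Φ₀(Ÿ_T)`** (constants' coordinate trivial).
[cite: MochizukiEtTh2009, Prop 1.4 p.21] -/
def thetaPolesCarrier : OrdInt (constFld d T T.ydd).K × (deckAction d T).phiZero (cptGSet d T) := (1, thetaPolesGeom' d T)

/-- `thetaZerosCarrier` is an element of `Φ₀(Ÿ_T)` of the ruled data (same type, definitionally). [cite: MochizukiEtTh2009, Def 3.3 p.73] -/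
theorem thetaZerosCarrier_eq : (thetaZerosCarrier d T : (divisorMonoids d T).Φ₀.obj (op T.ydd)) = (1, thetaZerosGeom' d T) := rfl

/-- `thetaPolesCarrier` is an element of `Φ₀(Ÿ_T)` of the ruled data (same type, definitionally). [cite: MochizukiEtTh2009, Def 3.3 p.73] -/
theorem thetaPolesCarrier_eq : (thetaPolesCarrier d T : (divisorMonoids d T).Φ₀.obj (op T.ydd)) = (1, thetaPolesGeom' d T) := rfl

/-- The zero divisor is CUSPIDAL in the ruled data (`csp₀ = 1 × csp`). [cite: MochizukiEtTh2009, Prop 1.4 p.21] -/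
theorem thetaZerosCarrier_mem_csp₀ :
    (thetaZerosCarrier d T : (divisorMonoids d T).Φ₀.obj (op T.ydd)) ∈ (divisorMonoids d T).csp₀ (op T.ydd) :=
  ⟨Submonoid.one_mem _, thetaZerosGeom'_mem_cspZero d T⟩

/-- The polar divisor is NON-CUSPIDAL in the ruled data (`ncsp₀ = ord(𝒪^▷) × ncsp`). [cite: MochizukiEtTh2009, Prop 1.4 p.21] -/
theorem thetaPolesCarrier_mem_ncsp₀ :
    (thetaPolesCarrier d T : (divisorMonoids d T).Φ₀.obj (op T.ydd)) ∈ (divisorMonoids d T).ncsp₀ (op T.ydd) :=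
  ⟨trivial, thetaPolesGeom'_mem_ncspZero d T⟩

/-- The zero divisor is non-trivial. [cite: MochizukiEtTh2009, Prop 1.4 p.21] -/
theorem thetaZerosCarrier_ne_one : thetaZerosCarrier d T ≠ 1 := fun h =>
  thetaZerosGeom'_ne_one d T (congrArg Prod.snd h)

/-- The polar divisor is non-trivial. [cite: MochizukiEtTh2009, Prop 1.4 p.21] -/
theorem thetaPolesCarrier_ne_one : thetaPolesCarrier d T ≠ 1 := fun h =>
  thetaPolesGeom'_ne_one d T (congrArg Prod.snd h)

/-- The values of an element of `Φ₀^geom(S)` are effective log-divisors: all multiplicities are non-negative.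
[cite: MochizukiEtTh2009, Def 3.3 p.73] -/
theorem toAdd_phiZero_nonneg {S : Action (Type 0) P} (φ : (deckAction d T).phiZero S) (s : S.V) (x : Envelope.Idx (Cpt d T)) :
    0 ≤ Multiplicative.toAdd (φ.1 s) x :=
  (φ.2.1 s).2 x

/-- **A common divisor in `Φ₀^geom(Ÿ_T)` of the zero family `[cusps]` and the polar family `[F_x]` is trivial** — disjoint supports: `[cusps]`
has no component, `[F_x]` no cusp, and divisors in `Φ₀^geom` are effective. [cite: MochizukiEtTh2009, Def 4.1 (i) p.86] -/
theorem eq_one_of_dvd_thetaZerosGeom'_of_dvd_thetaPolesGeom' (c : (deckAction d T).phiZero (cptGSet d T))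
    (hz : c ∣ thetaZerosGeom' d T) (hp : c ∣ thetaPolesGeom' d T) : c = 1 := by
  obtain ⟨k, hk⟩ := hz
  obtain ⟨k', hk'⟩ := hp
  refine Subtype.ext (funext fun s => Multiplicative.toAdd.injective (funext fun x => ?_))
  have hc := toAdd_phiZero_nonneg d T c s x
  have hks := toAdd_phiZero_nonneg d T k s x
  have hk's := toAdd_phiZero_nonneg d T k' s x
  -- the pointwise equations `c s · k s = [cusps]` and `c s · k' s = [F_s]`
  have e1 : Multiplicative.toAdd (c.1 s) x + Multiplicative.toAdd (k.1 s) x = Multiplicative.toAdd ((thetaZerosGeom' d T).1 s) x := by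
    rw [hk]; rfl
  have e2 : Multiplicative.toAdd (c.1 s) x + Multiplicative.toAdd (k'.1 s) x = Multiplicative.toAdd ((thetaPolesGeom' d T).1 s) x := by
    rw [hk']; rfl
  change Multiplicative.toAdd (c.1 s) x = 0
  rcases x with q | j
  · -- at a cusp the polar family vanishes
    have h0 : Multiplicative.toAdd ((thetaPolesGeom' d T).1 s) (Sum.inl q) = 0 := rfl
    rw [h0] at e2
    exact le_antisymm (by linarith) hc
  · -- along a component the zero family vanishes
    have h0 : Multiplicative.toAdd ((thetaZerosGeom' d T).1 s) (Sum.inr j) = 0 := rfl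
    rw [h0] at e1
    exact le_antisymm (by linarith) hc

/-- **`[zeros]` and `[poles]` are RELATIVELY PRIME in `Φ₀(Ÿ_T)`** — every common divisor is a unit (Def. 4.1 (i) «disjoint supports», monoid
form; the S0 `CarrierSpec.theta` clause `IsRelPrime Z Pl` at the term). [cite: MochizukiEtTh2009, Def 4.1 (i) p.86] -/
theorem isRelPrime_thetaZerosCarrier_thetaPolesCarrier : IsRelPrime (thetaZerosCarrier d T) (thetaPolesCarrier d T) := by
  rintro ⟨a, c⟩ hz hp
  rw [thetaZerosCarrier, Prod.mk_dvd_mk] at hz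
  rw [thetaPolesCarrier, Prod.mk_dvd_mk] at hp
  have ha : IsUnit a := isUnit_of_dvd_one hz.1
  have hc : c = 1 := eq_one_of_dvd_thetaZerosGeom'_of_dvd_thetaPolesGeom' d T c hz.2 hp.2
  rw [hc]
  exact Prod.isUnit_iff.mpr ⟨ha, isUnit_one⟩

/-- **`div₀ θ · ι₂[poles] = ι₂[zeros]` in `Φ₀(Ÿ_T)^gp`** — the divisor relation of the theta section in product form (the Def. 4.1 (i)
relation `Div(s′) − Div(s″) = Div_B(θ)`; S0's `divΛ θ · of Pl = of Z` before realification; `ι₂ = (constDivIncl's complement) MonoidHom.inr`,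
and `ι₂(of a) = of (1, a) = of thetaPolesCarrier / thetaZerosCarrier` by `gpMap_of`). [cite: MochizukiEtTh2009, Def 4.1 (i) p.86] -/
theorem div₀_thetaB₀_mul :
    (divisorMonoids d T).div₀ (op T.ydd) (thetaB₀ d T) * gpMap (MonoidHom.inr _ _) (Algebra.GrothendieckGroup.of (thetaPolesGeom' d T)) =
      gpMap (MonoidHom.inr _ _) (Algebra.GrothendieckGroup.of (thetaZerosGeom' d T)) := by
  rw [div₀_thetaB₀, map_one, one_mul, ← map_mul, div_mul_cancel]

/-- `ι₂(of [poles]) = of thetaPolesCarrier` (the named element of `Φ₀(Ÿ_T)`). [cite: MochizukiEtTh2009, Def 3.3 p.73] -/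
theorem gpMap_inr_of_thetaPolesGeom' :
    gpMap (MonoidHom.inr (OrdInt (constFld d T T.ydd).K) _) (Algebra.GrothendieckGroup.of (thetaPolesGeom' d T)) =
      Algebra.GrothendieckGroup.of (thetaPolesCarrier d T) :=
  gpMap_of _ _

/-- `ι₂(of [zeros]) = of thetaZerosCarrier`. [cite: MochizukiEtTh2009, Def 3.3 p.73] -/
theorem gpMap_inr_of_thetaZerosGeom' :
    gpMap (MonoidHom.inr (OrdInt (constFld d T T.ydd).K) _) (Algebra.GrothendieckGroup.of (thetaZerosGeom' d T)) =
      Algebra.GrothendieckGroup.of (thetaZerosCarrier d T) :=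
  gpMap_of _ _

end ArithThetaTower

end Literature.AnabelianGeometry.EtaleTheta

end
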